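import Mathlib
import HarnessLib
import Summits.Ventures.LatticeQCDFlow.Scoring.SplitChainGaps

/-!
# Regeneration at RANDOM regeneration times: the strong Markov property of the split chain at
# the first head after a given time, and at any head time decided by the past

HONEST FRAMING: exact (Metropolis-corrected) sampling algorithms for lattice gauge theory;
figures of merit are autocorrelation/cost numbers at stated couplings and volumes; no
continuum-physics claim.

Venture `LatticeQCDFlow` (cell pub-lqcd), topic `Scoring`; FANOUT row 8 (`s0-cpn-nemc`, GEN-16).
NEW WORK of the cell, not a published result; no definition is introduced.  The fixed-time
regeneration theorem (`Scoring/SplitChainPathLaw.lean`, `Scoring/SplitChainDependsOn.lean`) says: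
weighted by a nonnegative bounded functional of the past up to `b` and restricted to a head at
`b + 1`, the future path from `b + 1` is a fresh split chain from `ν ⊗ δ_true`.  This file removes the
two restrictions that kept it from being the STRONG MARKOV PROPERTY AT REGENERATION TIMES: (i) the
past weight may be SIGNED and the future functional merely INTEGRABLE (so that unbounded tour sums
and lengths are admissible); (ii) the head may sit at a RANDOM time.  A random time `T` with
`{T = t + 1} = D_t ∩ {coin_{t+1} = heads}`, `D_t` decided by the path up to `t` — the first head after
time `a`, the `i`-th head, the first head after the state enters a set, … — is handled WITHOUT a
definition: a family of past weights `G_t` (bounded measurable, `DependsOn (G t) (Set.Iic t)`,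
think `G_t = 1_{D_t} · Φ`) is summed against `1{coin_{t+1}} · H(θ_{t+1} X̂)` over `t`, finitely or as a
`tsum`; the identity `E[Σ_t G_t 1{coin_{t+1}} H(θ_{t+1} X̂)] = E[Σ_t G_t 1{coin_{t+1}}] · E_{ν̂}[H]` IS
`E[Φ_T H(θ_T X̂); T < ∞] = E[Φ_T; T < ∞] · E_{ν̂}[H]`.  Printed counterpart NAMED ONLY: the strong Markov property
of the split chain at regeneration times (Nummelin 1978; Athreya–Ney 1978; Meyn–Tweedie 1993
Prop. 3.4.6 / Thm 5.1.3 context; Kallenberg 2021 Thm 11.12) — nothing is cited as a fact.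

## Content (notation of `Scoring/SplitChain.lean`; `P̂ = P̂_{μ̂₀,κ̂}`, `P̂_ν̂` the split chain from
## `ν̂ = ν.map (·, true)`, `θ_s x̂ = (n ↦ x̂ (s + n))`, `e = ε.toReal`)

* **`splitChain_integrable_head_shift`** — `H` integrable under `P̂_ν̂` ⇒ `1{coin_{b+1}} · H ∘ θ_{b+1}`
  integrable under `P̂` (transfer through the fixed-time path-law identity);
* **`splitChain_regeneration_integral_signed`** — for bounded measurable `G` with
  `DependsOn G (Set.Iic b)` (any sign) and `H` integrable under `P̂_ν̂`:
  `E[G · 1{coin_{b+1}} · H(θ_{b+1} X̂)] = e · E[G] · E_{ν̂}[H]`; `splitChain_regeneration_integral_cond` —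
  the same as `= E[G · 1{coin_{b+1}}] · E_{ν̂}[H]`;
* **`splitChain_regeneration_randomTime_finset`** — for a family `G_t` as above and a finite set of
  times: `E[Σ_{t∈s} G_t 1{coin_{t+1}} H(θ_{t+1} X̂)] = E[Σ_{t∈s} G_t 1{coin_{t+1}}] · E_{ν̂}[H]`;
* **`splitChain_regeneration_randomTime`** — the same with `∑' t` under
  `Summable (t ↦ E[|G_t| 1{coin_{t+1}}])` (i.e. `E[|Φ_T|; T < ∞] < ∞`);
* the first head after time `a` (a.s. finite for `ε > 0`) is the instance worked out in
  `Scoring/SplitChainFirstRegeneration.lean`.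

Reading (value-free): the regeneration structure of the simulated chain is available at the random
times a sampler actually uses — "the next regeneration after now", "the `i`-th regeneration" — not
only at fixed times; with integrable (unbounded) future functionals, as tour sums require.  NOT
CLAIMED: the i.i.d. decomposition into tours (later files); anything about a concrete sampler's `ε`.
-/

noncomputable section

namespace Summit.Ventures.LatticeQCDFlow.Scoring

open MeasureTheory ProbabilityTheory Filter Finset Preorder Literature.Probability.MarkovChains
open scoped ENNReal

variable {Ω : Type*} [MeasurableSpace Ω]

section StrongMarkov

variable {κ : Kernel Ω Ω} [IsMarkovKernel κ] {ν : Measure Ω} [IsProbabilityMeasure ν] {ε : ℝ≥0∞}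
  {hmin : ∀ x {B : Set Ω}, MeasurableSet B → ε * ν B ≤ κ x B}
  (κs : Kernel (Ω × Bool) (Ω × Bool)) [IsMarkovKernel κs]
  (μs : Measure (Ω × Bool)) [IsProbabilityMeasure μs]

/-- **Integrability transfer.**  If `H` is integrable under the fresh split chain `P̂_ν̂`, then
`1{coin_{b+1}} · H(θ_{b+1} X̂)` is integrable under `P̂` (whatever the initial law). -/
theorem splitChain_integrable_head_shift (hε : ε < 1)
    (hκs : ∀ p, κs p = (ε • ν).map (fun y : Ω => (y, true))
      + ((1 - ε) • Doeblin.residualKernel κ ν ε hmin p.1).map (fun y : Ω => (y, false)))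
    (b : ℕ) {H : (ℕ → Ω × Bool) → ℝ}
    (hHi : Integrable H (Kernel.trajMeasure (X := fun _ : ℕ => Ω × Bool)
      (ν.map (fun y : Ω => (y, true)))
      (fun n : ℕ => κs.comap (fun h : (i : ↥(Finset.Iic n)) → Ω × Bool =>
        h ⟨n, Finset.mem_Iic.2 le_rfl⟩) (measurable_pi_apply _)))) :
    Integrable (fun x : ℕ → Ω × Bool =>
        (if (x (b + 1)).2 then (1 : ℝ) else 0) * H (fun n => x (b + 1 + n)))
      (Kernel.trajMeasure (X := fun _ : ℕ => Ω × Bool) μs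
        (fun n : ℕ => κs.comap (fun h : (i : ↥(Finset.Iic n)) → Ω × Bool =>
          h ⟨n, Finset.mem_Iic.2 le_rfl⟩) (measurable_pi_apply _))) := by
  set P := Kernel.trajMeasure (X := fun _ : ℕ => Ω × Bool) μs
      (fun n : ℕ => κs.comap (fun h : (i : ↥(Finset.Iic n)) → Ω × Bool =>
        h ⟨n, Finset.mem_Iic.2 le_rfl⟩) (measurable_pi_apply _)) with hP
  have hlaw := splitChain_regeneration_pathLaw κs μs (κ := κ) (ν := ν) (hmin := hmin) hε hκs b
    (F := fun _ => (1 : ℝ)) measurable_const (CF := 1) (fun _ => by simp) (fun _ => zero_le_one)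
  rw [← hP] at hlaw
  have hθ : Measurable (fun (x : ℕ → Ω × Bool) (n : ℕ) => x (b + 1 + n)) :=
    measurable_pi_lambda _ fun n => measurable_pi_apply _
  have hρm : Measurable fun x : ℕ → Ω × Bool =>
      ENNReal.ofReal ((fun _ => (1 : ℝ)) (frestrictLe b x) * (if (x (b + 1)).2 then (1 : ℝ) else 0)) :=
    (regenWeight_measurable b measurable_const).ennreal_ofReal
  have h1 : Integrable H ((P.withDensity fun x => ENNReal.ofReal
      ((fun _ => (1 : ℝ)) (frestrictLe b x) * (if (x (b + 1)).2 then (1 : ℝ) else 0))).map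
      (fun (x : ℕ → Ω × Bool) (n : ℕ) => x (b + 1 + n))) := by
    rw [hlaw]
    exact hHi.smul_measure ENNReal.ofReal_ne_top
  have h2 := (integrable_map_measure h1.aestronglyMeasurable hθ.aemeasurable).1 h1
  have h3 := (integrable_withDensity_iff_integrable_smul' hρm
    (ae_of_all _ fun x => ENNReal.ofReal_lt_top)).1 h2
  refine h3.congr (ae_of_all _ fun x => ?_)
  have h0 : 0 ≤ (if (x (b + 1)).2 then (1 : ℝ) else 0) := by split_ifs <;> norm_num
  simp only [Function.comp_apply, smul_eq_mul, one_mul, ENNReal.toReal_ofReal h0]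

/-- **REGENERATION WITH A SIGNED PAST WEIGHT AND AN INTEGRABLE FUTURE FUNCTIONAL.**  For bounded
measurable `G` with `DependsOn G (Set.Iic b)` (any sign) and `H` measurable and integrable under
`P̂_ν̂`: `E[G(X̂) · 1{coin_{b+1}} · H(θ_{b+1} X̂)] = e · E[G(X̂)] · E_{P̂_ν̂}[H]`. -/
theorem splitChain_regeneration_integral_signed (hε : ε < 1)
    (hκs : ∀ p, κs p = (ε • ν).map (fun y : Ω => (y, true))
      + ((1 - ε) • Doeblin.residualKernel κ ν ε hmin p.1).map (fun y : Ω => (y, false)))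
    (b : ℕ) {G : (ℕ → Ω × Bool) → ℝ} (hG : Measurable G) (hGd : DependsOn G (Set.Iic b))
    {CG : ℝ} (hCG : ∀ x, |G x| ≤ CG) {H : (ℕ → Ω × Bool) → ℝ} (hH : Measurable H)
    (hHi : Integrable H (Kernel.trajMeasure (X := fun _ : ℕ => Ω × Bool)
      (ν.map (fun y : Ω => (y, true)))
      (fun n : ℕ => κs.comap (fun h : (i : ↥(Finset.Iic n)) → Ω × Bool =>
        h ⟨n, Finset.mem_Iic.2 le_rfl⟩) (measurable_pi_apply _)))) :
    ∫ x, G x * (if (x (b + 1)).2 then (1 : ℝ) else 0) * H (fun n => x (b + 1 + n))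
        ∂(Kernel.trajMeasure (X := fun _ : ℕ => Ω × Bool) μs
          (fun n : ℕ => κs.comap (fun h : (i : ↥(Finset.Iic n)) → Ω × Bool =>
            h ⟨n, Finset.mem_Iic.2 le_rfl⟩) (measurable_pi_apply _)))
      = ε.toReal * (∫ x, G x
          ∂(Kernel.trajMeasure (X := fun _ : ℕ => Ω × Bool) μs
            (fun n : ℕ => κs.comap (fun h : (i : ↥(Finset.Iic n)) → Ω × Bool =>
              h ⟨n, Finset.mem_Iic.2 le_rfl⟩) (measurable_pi_apply _))))
        * ∫ y, H y ∂(Kernel.trajMeasure (X := fun _ : ℕ => Ω × Bool) (ν.map (fun y : Ω => (y, true)))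
          (fun n : ℕ => κs.comap (fun h : (i : ↥(Finset.Iic n)) → Ω × Bool =>
            h ⟨n, Finset.mem_Iic.2 le_rfl⟩) (measurable_pi_apply _))) := by
  set P := Kernel.trajMeasure (X := fun _ : ℕ => Ω × Bool) μs
      (fun n : ℕ => κs.comap (fun h : (i : ↥(Finset.Iic n)) → Ω × Bool =>
        h ⟨n, Finset.mem_Iic.2 le_rfl⟩) (measurable_pi_apply _)) with hP
  have hCG0 : 0 ≤ CG :=
    (abs_nonneg _).trans (hCG fun _ => Classical.choice (nonempty_of_isProbabilityMeasure μs))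
  -- the two nonnegative weights `G + CG` and `CG`
  have hplus := splitChain_regeneration_integral_dependsOn κs μs (κ := κ) (ν := ν) (hmin := hmin)
    hε hκs b (G := fun x => G x + CG) (hG.add_const _)
    (fun x y hxy => by show G x + CG = G y + CG; rw [hGd hxy]) (CG := CG + CG)
    (fun x => by
      rw [abs_of_nonneg (by linarith [neg_le_of_abs_le (hCG x)])]
      linarith [le_of_abs_le (hCG x)])
    (fun x => by linarith [neg_le_of_abs_le (hCG x)]) hH
  have hconst := splitChain_regeneration_integral_dependsOn κs μs (κ := κ) (ν := ν) (hmin := hmin)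
    hε hκs b (G := fun _ => CG) measurable_const (fun _ _ _ => rfl) (CG := CG)
    (fun _ => by rw [abs_of_nonneg hCG0]) (fun _ => hCG0) hH
  rw [← hP] at hplus hconst
  -- integrability of the pieces
  have hI := splitChain_integrable_head_shift κs μs (κ := κ) (ν := ν) (hmin := hmin) hε hκs b hHi
  rw [← hP] at hI
  have hI1 : Integrable (fun x : ℕ → Ω × Bool =>
      (G x + CG) * (if (x (b + 1)).2 then (1 : ℝ) else 0) * H (fun n => x (b + 1 + n))) P := by
    have h := hI.bdd_mul (c := CG + CG) (hG.add_const CG).aestronglyMeasurable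
      (ae_of_all _ fun x => by
        rw [Real.norm_eq_abs, abs_of_nonneg (by linarith [neg_le_of_abs_le (hCG x)])]
        linarith [le_of_abs_le (hCG x)])
    refine h.congr (ae_of_all _ fun x => ?_)
    simp only [mul_assoc]
  have hI2 : Integrable (fun x : ℕ → Ω × Bool =>
      CG * (if (x (b + 1)).2 then (1 : ℝ) else 0) * H (fun n => x (b + 1 + n))) P := by
    refine (hI.const_mul CG).congr (ae_of_all _ fun x => ?_)
    simp only [mul_assoc]
  have hGi : Integrable G P := integrable_of_bounded P hG hCG
  calc ∫ x, G x * (if (x (b + 1)).2 then (1 : ℝ) else 0) * H (fun n => x (b + 1 + n)) ∂P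
      = ∫ x, ((G x + CG) * (if (x (b + 1)).2 then (1 : ℝ) else 0) * H (fun n => x (b + 1 + n))
          - CG * (if (x (b + 1)).2 then (1 : ℝ) else 0) * H (fun n => x (b + 1 + n))) ∂P :=
        integral_congr_ae (ae_of_all _ fun x => by ring)
    _ = _ := integral_sub hI1 hI2
    _ = ε.toReal * (∫ x, G x ∂P) * ∫ y, H y
          ∂(Kernel.trajMeasure (X := fun _ : ℕ => Ω × Bool) (ν.map (fun y : Ω => (y, true)))
            (fun n : ℕ => κs.comap (fun h : (i : ↥(Finset.Iic n)) → Ω × Bool =>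
              h ⟨n, Finset.mem_Iic.2 le_rfl⟩) (measurable_pi_apply _))) := by
        rw [hplus, hconst, integral_add hGi (integrable_const CG), integral_const, probReal_univ,
          one_smul]
        ring

/-- **… in conditional form**: `E[G · 1{coin_{b+1}} · H(θ_{b+1} X̂)] = E[G · 1{coin_{b+1}}] · E_{P̂_ν̂}[H]`. -/
theorem splitChain_regeneration_integral_cond (hε : ε < 1)
    (hκs : ∀ p, κs p = (ε • ν).map (fun y : Ω => (y, true))
      + ((1 - ε) • Doeblin.residualKernel κ ν ε hmin p.1).map (fun y : Ω => (y, false)))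
    (b : ℕ) {G : (ℕ → Ω × Bool) → ℝ} (hG : Measurable G) (hGd : DependsOn G (Set.Iic b))
    {CG : ℝ} (hCG : ∀ x, |G x| ≤ CG) {H : (ℕ → Ω × Bool) → ℝ} (hH : Measurable H)
    (hHi : Integrable H (Kernel.trajMeasure (X := fun _ : ℕ => Ω × Bool)
      (ν.map (fun y : Ω => (y, true)))
      (fun n : ℕ => κs.comap (fun h : (i : ↥(Finset.Iic n)) → Ω × Bool =>
        h ⟨n, Finset.mem_Iic.2 le_rfl⟩) (measurable_pi_apply _)))) :
    ∫ x, G x * (if (x (b + 1)).2 then (1 : ℝ) else 0) * H (fun n => x (b + 1 + n))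
        ∂(Kernel.trajMeasure (X := fun _ : ℕ => Ω × Bool) μs
          (fun n : ℕ => κs.comap (fun h : (i : ↥(Finset.Iic n)) → Ω × Bool =>
            h ⟨n, Finset.mem_Iic.2 le_rfl⟩) (measurable_pi_apply _)))
      = (∫ x, G x * (if (x (b + 1)).2 then (1 : ℝ) else 0)
          ∂(Kernel.trajMeasure (X := fun _ : ℕ => Ω × Bool) μs
            (fun n : ℕ => κs.comap (fun h : (i : ↥(Finset.Iic n)) → Ω × Bool =>
              h ⟨n, Finset.mem_Iic.2 le_rfl⟩) (measurable_pi_apply _))))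
        * ∫ y, H y ∂(Kernel.trajMeasure (X := fun _ : ℕ => Ω × Bool) (ν.map (fun y : Ω => (y, true)))
          (fun n : ℕ => κs.comap (fun h : (i : ↥(Finset.Iic n)) → Ω × Bool =>
            h ⟨n, Finset.mem_Iic.2 le_rfl⟩) (measurable_pi_apply _))) := by
  rw [splitChain_regeneration_integral_signed κs μs (κ := κ) (ν := ν) (hmin := hmin) hε hκs b hG
    hGd hCG hH hHi, splitChain_coin_dependsOn κs μs (κ := κ) (ν := ν) (hmin := hmin) hε hκs b hG
    hGd hCG]

/-- **REGENERATION AT A RANDOM REGENERATION TIME (finitely many candidate times).**  For a family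
`G_t` of bounded measurable past weights, `DependsOn (G t) (Set.Iic t)`, `H` integrable under `P̂_ν̂`
and a finite set `s` of times:
`E[Σ_{t∈s} G_t · 1{coin_{t+1}} · H(θ_{t+1} X̂)] = E[Σ_{t∈s} G_t · 1{coin_{t+1}}] · E_{P̂_ν̂}[H]`.
With `G_t = 1_{D_t} · Φ_t`, `D_t` decided by the path up to `t`, and `T := t + 1` on
`D_t ∩ {coin_{t+1}}` (a regeneration time), this reads `E[Φ_T H(θ_T X̂); T − 1 ∈ s] = E[Φ_T; T − 1 ∈ s] · E_{ν̂}[H]`. -/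
theorem splitChain_regeneration_randomTime_finset (hε : ε < 1)
    (hκs : ∀ p, κs p = (ε • ν).map (fun y : Ω => (y, true))
      + ((1 - ε) • Doeblin.residualKernel κ ν ε hmin p.1).map (fun y : Ω => (y, false)))
    {G : ℕ → (ℕ → Ω × Bool) → ℝ} (hG : ∀ t, Measurable (G t))
    (hGd : ∀ t, DependsOn (G t) (Set.Iic t)) {CG : ℕ → ℝ} (hCG : ∀ t x, |G t x| ≤ CG t)
    {H : (ℕ → Ω × Bool) → ℝ} (hH : Measurable H)
    (hHi : Integrable H (Kernel.trajMeasure (X := fun _ : ℕ => Ω × Bool)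
      (ν.map (fun y : Ω => (y, true)))
      (fun n : ℕ => κs.comap (fun h : (i : ↥(Finset.Iic n)) → Ω × Bool =>
        h ⟨n, Finset.mem_Iic.2 le_rfl⟩) (measurable_pi_apply _)))) (s : Finset ℕ) :
    ∫ x, ∑ t ∈ s, G t x * (if (x (t + 1)).2 then (1 : ℝ) else 0) * H (fun n => x (t + 1 + n))
        ∂(Kernel.trajMeasure (X := fun _ : ℕ => Ω × Bool) μs
          (fun n : ℕ => κs.comap (fun h : (i : ↥(Finset.Iic n)) → Ω × Bool =>
            h ⟨n, Finset.mem_Iic.2 le_rfl⟩) (measurable_pi_apply _)))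
      = (∫ x, ∑ t ∈ s, G t x * (if (x (t + 1)).2 then (1 : ℝ) else 0)
          ∂(Kernel.trajMeasure (X := fun _ : ℕ => Ω × Bool) μs
            (fun n : ℕ => κs.comap (fun h : (i : ↥(Finset.Iic n)) → Ω × Bool =>
              h ⟨n, Finset.mem_Iic.2 le_rfl⟩) (measurable_pi_apply _))))
        * ∫ y, H y ∂(Kernel.trajMeasure (X := fun _ : ℕ => Ω × Bool) (ν.map (fun y : Ω => (y, true)))
          (fun n : ℕ => κs.comap (fun h : (i : ↥(Finset.Iic n)) → Ω × Bool =>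
            h ⟨n, Finset.mem_Iic.2 le_rfl⟩) (measurable_pi_apply _))) := by
  set P := Kernel.trajMeasure (X := fun _ : ℕ => Ω × Bool) μs
      (fun n : ℕ => κs.comap (fun h : (i : ↥(Finset.Iic n)) → Ω × Bool =>
        h ⟨n, Finset.mem_Iic.2 le_rfl⟩) (measurable_pi_apply _)) with hP
  have hIt : ∀ t ∈ s, Integrable (fun x : ℕ → Ω × Bool =>
      G t x * (if (x (t + 1)).2 then (1 : ℝ) else 0) * H (fun n => x (t + 1 + n))) P := by
    intro t _
    have hI := splitChain_integrable_head_shift κs μs (κ := κ) (ν := ν) (hmin := hmin) hε hκs t hHi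
    rw [← hP] at hI
    refine (hI.bdd_mul (c := CG t) (hG t).aestronglyMeasurable
      (ae_of_all _ fun x => by rw [Real.norm_eq_abs]; exact hCG t x)).congr
      (ae_of_all _ fun x => ?_)
    simp only [mul_assoc]
  have hIt' : ∀ t ∈ s, Integrable (fun x : ℕ → Ω × Bool =>
      G t x * (if (x (t + 1)).2 then (1 : ℝ) else 0)) P := by
    intro t _
    refine integrable_of_bounded P ((hG t).mul (measurable_coinHeads (t + 1))) (C := CG t * 1)
      fun x => ?_
    rw [abs_mul]
    refine mul_le_mul (hCG t x) ?_ (abs_nonneg _) ((abs_nonneg _).trans (hCG t x))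
    split_ifs <;> simp
  rw [integral_finsetSum _ hIt, integral_finsetSum _ hIt', Finset.sum_mul]
  refine Finset.sum_congr rfl fun t _ => ?_
  rw [hP]
  exact splitChain_regeneration_integral_cond κs μs (κ := κ) (ν := ν) (hmin := hmin) hε hκs t (hG t)
    (hGd t) (hCG t) hH hHi

/-- **REGENERATION AT A RANDOM REGENERATION TIME.**  Same, summed over ALL times: if
`Σ_t E[|G_t| · 1{coin_{t+1}}] < ∞` (i.e. `E[|Φ_T|; T < ∞] < ∞`), then
`E[∑' t, G_t · 1{coin_{t+1}} · H(θ_{t+1} X̂)] = (∑' t, E[G_t · 1{coin_{t+1}}]) · E_{P̂_ν̂}[H]`, i.e.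
`E[Φ_T · H(θ_T X̂); T < ∞] = E[Φ_T; T < ∞] · E_{ν̂}[H]` — at a regeneration time the future path is a
fresh split chain, independent of everything decided before it. -/
theorem splitChain_regeneration_randomTime (hε : ε < 1)
    (hκs : ∀ p, κs p = (ε • ν).map (fun y : Ω => (y, true))
      + ((1 - ε) • Doeblin.residualKernel κ ν ε hmin p.1).map (fun y : Ω => (y, false)))
    {G : ℕ → (ℕ → Ω × Bool) → ℝ} (hG : ∀ t, Measurable (G t))
    (hGd : ∀ t, DependsOn (G t) (Set.Iic t)) {CG : ℕ → ℝ} (hCG : ∀ t x, |G t x| ≤ CG t)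
    {H : (ℕ → Ω × Bool) → ℝ} (hH : Measurable H)
    (hHi : Integrable H (Kernel.trajMeasure (X := fun _ : ℕ => Ω × Bool)
      (ν.map (fun y : Ω => (y, true)))
      (fun n : ℕ => κs.comap (fun h : (i : ↥(Finset.Iic n)) → Ω × Bool =>
        h ⟨n, Finset.mem_Iic.2 le_rfl⟩) (measurable_pi_apply _))))
    (hsum : Summable fun t : ℕ => ∫ x, |G t x| * (if (x (t + 1)).2 then (1 : ℝ) else 0)
      ∂(Kernel.trajMeasure (X := fun _ : ℕ => Ω × Bool) μs
        (fun n : ℕ => κs.comap (fun h : (i : ↥(Finset.Iic n)) → Ω × Bool =>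
          h ⟨n, Finset.mem_Iic.2 le_rfl⟩) (measurable_pi_apply _)))) :
    ∫ x, ∑' t, G t x * (if (x (t + 1)).2 then (1 : ℝ) else 0) * H (fun n => x (t + 1 + n))
        ∂(Kernel.trajMeasure (X := fun _ : ℕ => Ω × Bool) μs
          (fun n : ℕ => κs.comap (fun h : (i : ↥(Finset.Iic n)) → Ω × Bool =>
            h ⟨n, Finset.mem_Iic.2 le_rfl⟩) (measurable_pi_apply _)))
      = (∑' t, ∫ x, G t x * (if (x (t + 1)).2 then (1 : ℝ) else 0)
          ∂(Kernel.trajMeasure (X := fun _ : ℕ => Ω × Bool) μs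
            (fun n : ℕ => κs.comap (fun h : (i : ↥(Finset.Iic n)) → Ω × Bool =>
              h ⟨n, Finset.mem_Iic.2 le_rfl⟩) (measurable_pi_apply _))))
        * ∫ y, H y ∂(Kernel.trajMeasure (X := fun _ : ℕ => Ω × Bool) (ν.map (fun y : Ω => (y, true)))
          (fun n : ℕ => κs.comap (fun h : (i : ↥(Finset.Iic n)) → Ω × Bool =>
            h ⟨n, Finset.mem_Iic.2 le_rfl⟩) (measurable_pi_apply _))) := by
  set P := Kernel.trajMeasure (X := fun _ : ℕ => Ω × Bool) μs
      (fun n : ℕ => κs.comap (fun h : (i : ↥(Finset.Iic n)) → Ω × Bool =>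
        h ⟨n, Finset.mem_Iic.2 le_rfl⟩) (measurable_pi_apply _)) with hP
  set Pν := Kernel.trajMeasure (X := fun _ : ℕ => Ω × Bool) (ν.map (fun y : Ω => (y, true)))
      (fun n : ℕ => κs.comap (fun h : (i : ↥(Finset.Iic n)) → Ω × Bool =>
        h ⟨n, Finset.mem_Iic.2 le_rfl⟩) (measurable_pi_apply _)) with hPν
  -- each term is integrable, and the integrals of the absolute values are summable
  have hIt : ∀ t, Integrable (fun x : ℕ → Ω × Bool =>
      G t x * (if (x (t + 1)).2 then (1 : ℝ) else 0) * H (fun n => x (t + 1 + n))) P := by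
    intro t
    have hI := splitChain_integrable_head_shift κs μs (κ := κ) (ν := ν) (hmin := hmin) hε hκs t hHi
    rw [← hP] at hI
    refine (hI.bdd_mul (c := CG t) (hG t).aestronglyMeasurable
      (ae_of_all _ fun x => by rw [Real.norm_eq_abs]; exact hCG t x)).congr
      (ae_of_all _ fun x => ?_)
    simp only [mul_assoc]
  have habs : ∀ t, ∫ x, ‖G t x * (if (x (t + 1)).2 then (1 : ℝ) else 0)
      * H (fun n => x (t + 1 + n))‖ ∂P
      = (∫ x, |G t x| * (if (x (t + 1)).2 then (1 : ℝ) else 0) ∂P) * ∫ y, |H y| ∂Pν := by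
    intro t
    have hGa : Measurable fun x => |G t x| := (hG t).abs
    have hGad : DependsOn (fun x => |G t x|) (Set.Iic t) := fun x y hxy => by
      show |G t x| = |G t y|; rw [hGd t hxy]
    have hCGa : ∀ x, |(fun x => |G t x|) x| ≤ CG t := fun x => by
      show |(|G t x|)| ≤ CG t; rw [abs_abs]; exact hCG t x
    have h := splitChain_regeneration_integral_cond κs μs (κ := κ) (ν := ν) (hmin := hmin) hε hκs t
      hGa hGad hCGa hH.abs hHi.abs
    rw [← hP, ← hPν] at h
    rw [← h]
    refine integral_congr_ae (ae_of_all _ fun x => ?_)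
    beta_reduce
    rw [Real.norm_eq_abs, abs_mul, abs_mul]
    congr 1
    congr 1
    split_ifs <;> simp
  have hsum' : Summable fun t : ℕ => ∫ x, ‖G t x * (if (x (t + 1)).2 then (1 : ℝ) else 0)
      * H (fun n => x (t + 1 + n))‖ ∂P := by
    simp_rw [habs]
    exact hsum.mul_right _
  rw [← integral_tsum_of_summable_integral_norm hIt hsum', ← tsum_mul_right]
  refine tsum_congr fun t => ?_
  rw [hP, hPν]
  exact splitChain_regeneration_integral_cond κs μs (κ := κ) (ν := ν) (hmin := hmin) hε hκs t (hG t)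
    (hGd t) (hCG t) hH hHi

end StrongMarkov

end Summit.Ventures.LatticeQCDFlow.Scoring

end
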